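import Summits.BirchSwinnertonDyer.BirchSwinnertonDyer.Theorems.GenusKolyvaginAtTwoK4NegPhantomCellDescentBitFrames
import HarnessLib

/-!
# Route `GenusKolyvaginAtTwo`, crux K₄⁻ `K4Neg` (stmt-BirchSwinnertonDyer-31526), the phantom cell F4ᵖᵍ — THE HEEGNER DESCENT BIT,
# part 6: EXACTNESS IN `K`-CURRENCY — `hHalf` ⟺ «no `K`-point has Kummer class `res_K ξ_E`» ⟺ «`ξ_E` is not the capitulating class `s_y`»

Seat `bsd-line-gk2-p3` g34 (PROVER seat 3/3, cell `bsd-f1-sign2`), `--supports stmt-BirchSwinnertonDyer-31526 --as helper`.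
THEOREMS ONLY (no definition, no named fact, no `sorry`); standard axioms; UNCONDITIONAL.  **BSD is NOT proved by this file; K4Neg is NOT
proved; nothing is closed.**

LEAD gk2-p1 g28's one-bit residual of the whole K₄⁻ cell (p788592/p788928) is `hHalf` := «every `R ∈ E(K)` with a half fixed by `Γ_{K(E[4])}`
lies in `2E(K)`»; his OPEN item (i) asks for the kernel equivalences `hHalf ⟺ κ₂(g) ≠ res_K ξ_E ⟺ …`.  This file:
* §1 `not_hHalf_iff_exists_kummer_eq_resTorsion` — **`¬hHalf ⟺ ∃ R ∈ E(K), ∃ half Q, κ(Q) = res_K ξ`** (frame: `ρ_{E,2^n}` onto, `K` imaginary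
  quadratic, `d_K` odd, the two B₂ non-squares; `ξ ≠ 0` dying on `Γ_{ℚ(E[4])}`).  ⟸ is part 5 §1; ⟹ is Lawson–Wuthrich rigidity over `K`
  (gk2-p4 g31 `eq_zero_or_eq_resTorsion_of_forall_torsionFixing_pow` at level `4`) plus the Kummer kernel.
* §2 `exists_kummer_eq_resTorsion_iff_eq_of_generator` — if `E(K)/2E(K)` is generated by one point `Q₀` (`R = m•Q₀ + 2R'` for every `R`; on the
  K₄⁻ cell `Q₀ = y_K/2^{M₀}`, rank `E(K) = 1`, `E(K)[2] = 0`) and `s` is the class with `res_K s = κ(Q₀)` (the CAPITULATING class `s_y` of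
  `GenusSupplyNarrow.KFourCell.existsUnique_resTorsion_eq_kummer_of_depth_pos_of_cell'`), then **(∃ R Q, κ(Q) = res_K ξ) ⟺ ξ = s**.
* §3 ★ `hHalf_iff_ne_capitulatingClass` — **`hHalf ⟺ ξ_E ≠ s_y`**; with part 3 (`(α) ⟹ hHalf`) and gk2-p4 g34's trace bit
  (`[ξ_E, F·F] ≠ 0 ⟺ a_{ℓ₀} ≡ 2 (mod 4)`, p789093/p789412) this is the complete kernel dictionary of the residual bit.

References: [LawsonWuthrich2016] §3, §7.1; [Kramer1981] Thm. 1 (the capitulating class); [GrossLMS1991] §9 Prop. 9.1; [SilvermanAEC2009] VIII.§2.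
-/

set_option linter.dupNamespace false -- tree convention: `Summit.BirchSwinnertonDyer.BirchSwinnertonDyer.Theorems` (summit = sub-problem)
set_option autoImplicit false

noncomputable section

open scoped Classical NumberField Pointwise

namespace Summit.BirchSwinnertonDyer.BirchSwinnertonDyer.Theorems.GenusExact.PhantomDescentBit

open WeierstrassCurve NumberField IsDedekindDomain Field
open Literature.NumberTheory.GaloisRepresentations Literature.NumberTheory.EllipticCurves
open Summit.BirchSwinnertonDyer.BirchSwinnertonDyer.Theorems.GenusExact.Lw2PhantomExclusion
open Summit.BirchSwinnertonDyer.BirchSwinnertonDyer.Theorems.KolyvaginLowerBoundAtTwo (torsionFixing_le_of_dvd)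

/-- `(2 : ℤ) • c = 0` for `c ∈ H¹(F, E[2])`. [folklore] -/
theorem two_zsmul_galH1Torsion_two {F : Type} [Field F] (V : WeierstrassCurve F) (c : galH1Torsion V (2 : ℤ)) :
    (2 : ℤ) • c = 0 := by
  rw [two_zsmul, ← two_nsmul]
  exact two_nsmul_galH1Torsion_two V c

variable (W : WeierstrassCurve ℚ) [W.IsElliptic] {K : Type} [Field K] [NumberField K]

/-! ## §1 `¬hHalf` ⟺ some `K`-point has Kummer class `res_K ξ` -/

/-- **`¬hHalf ⟺ ∃ R ∈ E(K), ∃ Q ∈ E_K(K̄), 2Q = ι R ∧ κ(Q) = res_K ξ`.**  Frame: `ρ_{E,2^n}` onto for all `n ≥ 1`; `K` imaginary quadratic with `d_K` odd and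
`d_K·(−|Δ|)`, `d_K·(−2|Δ|)` non-squares; `ξ ∈ H¹(ℚ, E[2])` non-zero dying on `Γ_{ℚ(E[4])}`.  `hHalf` (LEAD gk2-p1 g28, p788592) := every `R ∈ E(K)`
having a half fixed by `Γ_{K(E[4])}` lies in `2E(K)`.  ⟹: such a half `Q` with `R ∉ 2E(K)` has Kummer class dying on `Γ_{K(E[4])}`, hence `0` or `res_K ξ`
(Lawson–Wuthrich over `K`), and not `0` (Kummer kernel); ⟸: part 5 §1.  [cite: LawsonWuthrich2016, §3, §7.1] [cite: SilvermanAEC2009, VIII.§2] -/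
theorem not_hHalf_iff_exists_kummer_eq_resTorsion
    (hρ : ∀ n : ℕ, 0 < n → W.HasSurjectiveModNGaloisRep ((2 : ℤ) ^ n)) (hK : IsImaginaryQuadratic K)
    (hodd : Odd (NumberField.discr K)) (hnsq₁ : ¬ IsSquare ((NumberField.discr K : ℚ) * -|W.Δ|))
    (hnsq₂ : ¬ IsSquare ((NumberField.discr K : ℚ) * (-(2 * |W.Δ|))))
    {ξ : galH1Torsion W (2 : ℤ)} (hξ0 : ξ ≠ 0) (hξ4 : ∀ h ∈ torsionFixing W (4 : ℤ), h1Eval W (2 : ℤ) ξ h = 0) :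
    (∃ (R : (W.baseChange K).toAffine.Point) (Q : geomPoints (W.baseChange K)),
        (∀ ρ ∈ torsionFixing (W.baseChange K) (4 : ℤ), ρ • Q = Q) ∧ (2 : ℤ) • Q = toGeomPoints (W.baseChange K) R ∧
        ¬ ∃ R' : (W.baseChange K).toAffine.Point, (2 : ℤ) • R' = R) ↔
      ∃ (R : (W.baseChange K).toAffine.Point) (Q : geomPoints (W.baseChange K))
        (hQ : (2 : ℤ) • Q = toGeomPoints (W.baseChange K) R),
        kummerClassTorsion (W.baseChange K) (2 : ℤ) Q (by rw [hQ]; exact toGeomPoints_mem_fixedPoints _ _) =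
          resTorsion W K (2 : ℤ) ξ := by
  have h42 : torsionFixing (W.baseChange K) (4 : ℤ) ≤ torsionFixing (W.baseChange K) (2 : ℤ) :=
    torsionFixing_le_of_dvd (W.baseChange K) (by norm_num)
  constructor
  · rintro ⟨R, Q, hfix, hQ, hndiv⟩
    have hQmem : (2 : ℤ) • Q ∈ MulAction.fixedPoints (absoluteGaloisGroup K) (geomPoints (W.baseChange K)) := by
      rw [hQ]; exact toGeomPoints_mem_fixedPoints _ _
    refine ⟨R, Q, hQ, ?_⟩
    -- the Kummer class of `Q` dies on `Γ_{K(E[4])} = Γ_{K(E[2^2])}`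
    have hz : ∀ ρ ∈ torsionFixing (W.baseChange K) ((2 ^ 2 : ℕ) : ℤ),
        h1Eval (W.baseChange K) (2 : ℤ) (kummerClassTorsion (W.baseChange K) (2 : ℤ) Q hQmem) ρ = 0 := by
      intro ρ hρ'
      have hρ4 : ρ ∈ torsionFixing (W.baseChange K) (4 : ℤ) := by exact_mod_cast hρ'
      apply Subtype.ext
      rw [GenusKolyTwistingPrime.coe_h1Eval_kummerClassTorsion (W.baseChange K) (2 : ℤ) Q hQmem (h42 hρ4), hfix ρ hρ4, sub_self]
      rfl
    rcases eq_zero_or_eq_resTorsion_of_forall_torsionFixing_pow W hρ hK hodd hnsq₁ hnsq₂ hξ0 hξ4 (le_refl 2) hz with h0 | hres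
    · -- `κ(Q) = 0` forces `R ∈ 2E(K)`
      exfalso
      apply hndiv
      obtain ⟨T, hT, hfixT⟩ := (kummerClassTorsion_eq_zero_iff (W.baseChange K) (2 : ℤ) Q hQmem).mp h0
      obtain ⟨R₁, hR₁⟩ := (mem_range_toGeomPoints_iff (W.baseChange K) (Q - T)).mpr hfixT
      have hT2 : (2 : ℤ) • T = 0 := (mem_geomTorsion_iff _ (2 : ℤ) T).mp hT
      refine ⟨R₁, toGeomPoints_injective (W.baseChange K) ?_⟩
      rw [map_zsmul, hR₁, smul_sub, hT2, sub_zero, hQ]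
    · exact hres
  · rintro ⟨R, Q, hQ, hκ⟩
    obtain ⟨hfix, hndiv⟩ := exists_fixed_root_not_two_dvd_of_kummer_eq_resTorsion W hρ hK hξ0 hξ4 R Q hQ hκ (le_refl 2)
    exact ⟨R, Q, fun ρ hρ' ↦ hfix ρ (by exact_mod_cast hρ'), hQ, hndiv⟩

/-! ## §2 With `E(K)/2E(K)` cyclic: the class is the capitulating class -/

/-- **If `E(K)/2E(K) = ⟨Q₀⟩` and `res_K s = κ(Q₀)`, then `(∃ R Q, κ(Q) = res_K ξ) ⟺ ξ = s`.**  Frame: `ρ̄_{E,2}` onto and `K` imaginary quadratic (so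
`E(K)[2] = 0` and `res_K` is injective on `H¹(ℚ, E[2])`, gk2-p4/KLW); `Q₀ ∈ E(K)` with every `R ∈ E(K)` of the form `m • Q₀ + 2 • R'` (on the K₄⁻ cell:
`Q₀ = y_K/2^{M₀}`, rank `E(K) = 1`); `s ∈ H¹(ℚ, E[2])` with `res_K s = κ(Q₀)` — the CAPITULATING class `s_y` (Kramer's class; tree
`KFourCell.existsUnique_resTorsion_eq_kummer_of_depth_pos_of_cell'`).  Proof: `κ(Q) = κ(R) = m·κ(Q₀) = res_K (m·s)` and `2s = 0`, `ξ ≠ 0` force `m` odd.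
[cite: Kramer1981, Thm. 1] [cite: GrossLMS1991, §9 Prop. 9.1] [cite: SilvermanAEC2009, VIII.§2] -/
theorem exists_kummer_eq_resTorsion_iff_eq_of_generator
    (hρ : ∀ n : ℕ, 0 < n → W.HasSurjectiveModNGaloisRep ((2 : ℤ) ^ n)) (hK : IsImaginaryQuadratic K)
    {ξ : galH1Torsion W (2 : ℤ)} (hξ0 : ξ ≠ 0)
    (hdiv : ∀ X : geomPoints (W.baseChange K), ∃ Y : geomPoints (W.baseChange K), (2 : ℤ) • Y = X)
    {Q₀ : (W.baseChange K).toAffine.Point}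
    (hcyc : ∀ R : (W.baseChange K).toAffine.Point, ∃ (m : ℤ) (R' : (W.baseChange K).toAffine.Point), R = m • Q₀ + (2 : ℤ) • R')
    {s : galH1Torsion W (2 : ℤ)} (hs : resTorsion W K (2 : ℤ) s = kummerMapTorsion (W.baseChange K) (2 : ℤ) hdiv Q₀) :
    (∃ (R : (W.baseChange K).toAffine.Point) (Q : geomPoints (W.baseChange K))
        (hQ : (2 : ℤ) • Q = toGeomPoints (W.baseChange K) R),
        kummerClassTorsion (W.baseChange K) (2 : ℤ) Q (by rw [hQ]; exact toGeomPoints_mem_fixedPoints _ _) =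
          resTorsion W K (2 : ℤ) ξ) ↔ ξ = s := by
  have h2 : Module.finrank ℚ K = 2 := hK.1
  obtain ⟨θ, hθ, hc⟩ := exists_sq_eq_discr_not_mem_range K h2
  have hinj := GenusExact.EigenClassesFinite.resTorsion_injective_of_noTorsion W K h2 hθ hc (2 : ℤ)
    (forall_two_zsmul_eq_zero_baseChange W hρ hK)
  -- `κ` of a root is the Kummer MAP of the point; `2 • κ(·) = 0`
  have hκ : ∀ (R : (W.baseChange K).toAffine.Point) (Q : geomPoints (W.baseChange K))
      (hQ : (2 : ℤ) • Q = toGeomPoints (W.baseChange K) R),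
      kummerClassTorsion (W.baseChange K) (2 : ℤ) Q (by rw [hQ]; exact toGeomPoints_mem_fixedPoints _ _) =
        kummerMapTorsion (W.baseChange K) (2 : ℤ) hdiv R := by
    intro R Q hQ
    rw [kummerMapTorsion_apply]
    exact (kummerMapTorsionFun_eq (W.baseChange K) (2 : ℤ) hdiv R Q hQ).symm
  have h2κ : ∀ R' : (W.baseChange K).toAffine.Point, kummerMapTorsion (W.baseChange K) (2 : ℤ) hdiv ((2 : ℤ) • R') = 0 := by
    intro R'
    rw [map_zsmul]
    exact two_zsmul_galH1Torsion_two (W.baseChange K) _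
  constructor
  · rintro ⟨R, Q, hQ, hκξ⟩
    obtain ⟨m, R', hR⟩ := hcyc R
    have h : resTorsion W K (2 : ℤ) ξ = resTorsion W K (2 : ℤ) (m • s) := by
      rw [← hκξ, hκ R Q hQ, hR, map_add, map_zsmul, h2κ, add_zero, map_zsmul, hs]
    have hξm : ξ = m • s := hinj h
    have h2s : (2 : ℤ) • s = 0 := two_zsmul_galH1Torsion_two W s
    -- `m` is odd (else `ξ = 0`), and an odd multiple of a `2`-torsion class is the class
    rcases Int.even_or_odd m with ⟨k, rfl⟩ | ⟨k, rfl⟩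
    · exfalso
      apply hξ0
      rw [hξm, ← two_mul, mul_comm, mul_zsmul, h2s, zsmul_zero]
    · rw [hξm, add_zsmul, one_zsmul, mul_comm, mul_zsmul, h2s, zsmul_zero, zero_add]
  · rintro rfl
    refine ⟨Q₀, zsmulRoot (W.baseChange K) (2 : ℤ) hdiv Q₀, zsmul_zsmulRoot (W.baseChange K) (2 : ℤ) hdiv Q₀, ?_⟩
    rw [hs, kummerMapTorsion_apply]
    rfl

/-! ## §3 `hHalf` ⟺ the Lawson–Wuthrich class is not the capitulating class -/

/-- ★ **`hHalf ⟺ ξ_E ≠ s_y`.**  Frame: `ρ_{E,2^n}` onto; `K` imaginary quadratic, `d_K` odd, the two B₂ non-squares; `ξ ≠ 0` dying on `Γ_{ℚ(E[4])}`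
(the Lawson–Wuthrich class `ξ_E`); `Q₀ ∈ E(K)` generating `E(K)/2E(K)` and `s` with `res_K s = κ(Q₀)` (on the K₄⁻ cell: `Q₀ = y_K/2^{M₀}`, `s = s_y` the
capitulating class of `KFourCell.existsUnique_resTorsion_eq_kummer_of_depth_pos_of_cell'`).  Then the LEAD's one-bit residual
**`hHalf` (every `R ∈ E(K)` with a half fixed by `Γ_{K(E[4])}` lies in `2E(K)`) holds iff `ξ ≠ s`.**  With part 3 (`[ξ, F·F] ≠ 0 ⟹ hHalf`)
and gk2-p4 g34's trace bit this is the full dictionary of the phantom cell's residual bit.  BSD is NOT proved by this.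
[cite: LawsonWuthrich2016, §7.1] [cite: Kramer1981, Thm. 1] [cite: GrossLMS1991, §9 Prop. 9.1] -/
theorem hHalf_iff_ne_capitulatingClass
    (hρ : ∀ n : ℕ, 0 < n → W.HasSurjectiveModNGaloisRep ((2 : ℤ) ^ n)) (hK : IsImaginaryQuadratic K)
    (hodd : Odd (NumberField.discr K)) (hnsq₁ : ¬ IsSquare ((NumberField.discr K : ℚ) * -|W.Δ|))
    (hnsq₂ : ¬ IsSquare ((NumberField.discr K : ℚ) * (-(2 * |W.Δ|))))
    {ξ : galH1Torsion W (2 : ℤ)} (hξ0 : ξ ≠ 0) (hξ4 : ∀ h ∈ torsionFixing W (4 : ℤ), h1Eval W (2 : ℤ) ξ h = 0)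
    (hdiv : ∀ X : geomPoints (W.baseChange K), ∃ Y : geomPoints (W.baseChange K), (2 : ℤ) • Y = X)
    {Q₀ : (W.baseChange K).toAffine.Point}
    (hcyc : ∀ R : (W.baseChange K).toAffine.Point, ∃ (m : ℤ) (R' : (W.baseChange K).toAffine.Point), R = m • Q₀ + (2 : ℤ) • R')
    {s : galH1Torsion W (2 : ℤ)} (hs : resTorsion W K (2 : ℤ) s = kummerMapTorsion (W.baseChange K) (2 : ℤ) hdiv Q₀) :
    (∀ (R : (W.baseChange K).toAffine.Point) (Q : geomPoints (W.baseChange K)),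
        (∀ ρ ∈ torsionFixing (W.baseChange K) (4 : ℤ), ρ • Q = Q) → (2 : ℤ) • Q = toGeomPoints (W.baseChange K) R →
        ∃ R' : (W.baseChange K).toAffine.Point, (2 : ℤ) • R' = R) ↔ ξ ≠ s := by
  constructor
  · intro hH heq
    obtain ⟨R, Q, hQ, hκ⟩ := (exists_kummer_eq_resTorsion_iff_eq_of_generator W hρ hK hξ0 hdiv hcyc hs).mpr heq
    obtain ⟨hfix, hndiv⟩ := exists_fixed_root_not_two_dvd_of_kummer_eq_resTorsion W hρ hK hξ0 hξ4 R Q hQ hκ (le_refl 2)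
    exact hndiv (hH R Q (fun ρ hρ' ↦ hfix ρ (by exact_mod_cast hρ')) hQ)
  · intro hne R Q hfix hQ
    by_contra hndiv
    obtain ⟨R₁, Q₁, hQ₁, hκ⟩ := (not_hHalf_iff_exists_kummer_eq_resTorsion W hρ hK hodd hnsq₁ hnsq₂ hξ0 hξ4).mp
      ⟨R, Q, hfix, hQ, hndiv⟩
    exact hne ((exists_kummer_eq_resTorsion_iff_eq_of_generator W hρ hK hξ0 hdiv hcyc hs).mp ⟨R₁, Q₁, hQ₁, hκ⟩)

end Summit.BirchSwinnertonDyer.BirchSwinnertonDyer.Theorems.GenusExact.PhantomDescentBit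

end
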